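import Summits.CriticalPhenomena.PercolationContinuityZ3.Theorems.Transplant.SkelPhiWinChainF
import Summits.CriticalPhenomena.PercolationContinuityZ3.Theorems.Transplant.KNLevelsStepVForced
import HarnessLib

/-!
# N2 (frames-only node), (S0) kit tier, Skel side part 5: **THE WINDOW CHAIN OF A SCHEDULE FRAME OVER (S0)-SHAPE KITS** — the F-twins of p1-g11's
# assembler `kitsAt_stepAF` (per-level forced-kit clauses ⟹ `TStep.KitsAtF` of the enlarged step) and of the ADDITIVE chain transfer over
# `KNLevels.chain_edge_from_source_F_KN` (interface of record (R-16); SkelPhiWinChainF §2)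

builds on p205010 (kernel theorem, internal audit signed; external expert review pending) through `chain_edge_from_source_F_KN` (part 2 of the
(S0) generic tier, from `AdditiveGluing_proof`).  Nothing here is a claim about the open node `SamePDropOfSkeletonFrm₁`.
Lane `prim-bschramm`, seat `prim-bschramm-p1` (gen 16); helper file (`--supports stmt-CriticalPhenomena-4575 --as helper`).
* **`kitsAt_stepAFF`** — `KitsAtF` of the enlarged step `k` from the per-level clause of the forced kit (the output shape of `kitClauseF` /
  `kitClause_frameF` / `kitClause_runXF/YF`) and the step data of `kitsAt_stepAF`;
* **`le_real_of_chainFF`** — the ADDITIVE window-chain estimate: per-step (S0)-kits at accuracy `δ ∈ (0,1]`, rim excess `≤ η`, `p < 1`, degrees `≤ Δ′`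
  give `P(o ↔ B₀) − (N+1)(C·δ + η) ≤ μA` for the absolute `C` of `chain_edge_additive_F_KN` — no source hypothesis, no `η ≤ δ/2`;
* **`lt_real_of_chainFF`** — the threshold-shaped transfer of `lt_real_of_chainF` with `KitsAt ↦ KitsAtF` in `hchain` (the shape the (F)
  column's readers consume verbatim).
[cite: KozmaNitzan2024, §4 Lemma 11 (pp. 22–23), Lemma 12 (pp. 23–25)] [this work]
-/

noncomputable section

open MeasureTheory ProbabilityTheory

namespace Summit.CriticalPhenomena.PercolationContinuityZ3.Theorems.Transplant

namespace Skelφ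

open Literature.Probability.Percolation Literature.Probability.LatticeModels SimpleGraph
open Literature.Probability.Percolation.KozmaNitzan
open KNLevels ChainPlanar
open Skel (winGraph winGraphIn)

variable {V : Type} [DecidableEq V]

namespace WinChainData

variable {G' : SimpleGraph V} [G'.LocallyFinite] (P : WinChainData V) (𝒲 : PlanarWindow G') (S : SchedFrame)

/-- **`KitsAtF` of the enlarged step `k`** (`k ≤ N`) from a subbox region in `G'`, finite support, the source off the region, a nonempty true target,
the count inequality and the per-level clause OF THE FORCED KIT towards the enlarged target (for `G' = winGraph …` the clause is `Skelφ.kitClauseF` /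
`kitClause_frameF` / `kitClause_runXF/YF`). [cite: KozmaNitzan2024, §4 Lemma 10 (p. 17)] [this work] -/
theorem kitsAt_stepAFF (hRl : P.Rlev + 1 ≤ S.R') (hRim : ∀ k, P.Rim k ⊆ 𝒲.stepDF S k) {k : ℕ} (hk : k ≤ S.N)
    (hTne : (𝒲.coreTF S k).Nonempty) {Wt : Sym2 V → unitInterval} {p : unitInterval} {Δ : ℕ} {δ : ℝ}
    (hsub : IsSubbox G' Wt p (𝒲.stepDF S k)) (hfin : FinSupp Wt P.Sfin) (hDS : 𝒲.stepDF S k ⊆ P.Sfin)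
    (ho : P.o ∉ 𝒲.stepDF S k) (hoS : P.o ∈ P.Sfin) (hj : P.j₁ ≤ P.Rlev)
    (hcount : 1 / (1 - (p : ℝ)) ^ (Δ * P.N) ≤ δ * ((Finset.Icc P.j₀ P.j₁).card : ℝ))
    (hkits : ∀ j ∈ Finset.Icc P.j₀ P.j₁, ∃ (σ : SData V) (Sz : Finset V),
      SHyp (P.stepLF 𝒲 S k) j σ ∧ σ.N ≤ P.N ∧ (1 - (p : ℝ) ^ σ.sB) ^ σ.k ≤ δ ∧ Sz ⊆ 𝒲.stepDF S k ∧ (∀ x ∈ σ.K, σ.face x ⊆ Sz) ∧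
      RelayClause (P.stepLF 𝒲 S k) Wt j σ Sz (P.coreEF 𝒲 S k) (𝒲.stepDF S k) δ) :
    (P.stepAF 𝒲 S k).KitsAtF Wt p Δ δ :=
  ⟨P.lhyp_stepF 𝒲 S k hsub hfin hDS (P.enclF 𝒲 S hRl hk) ho hoS, hj, P.coreEF_subset_stepDF 𝒲 S hRim hk,
    hTne.mono (P.coreTF_subset_coreEF 𝒲 S k), hcount, hkits⟩

/-- **THE ADDITIVE WINDOW CHAIN OVER (S0)-SHAPE KITS**: the chain of `S.N + 1` steps in `G'` under a weighting `W'` with per-step facts and per-level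
forced-kit clauses at accuracy `δ ∈ (0, 1]`, nonempty true targets, rim parts inside the regions with rim excess `≤ η`, degrees `≤ Δ′`, `p < 1`, the last
core inside `Ft` and `P_{W'}(⋃ t ∈ Ft, o ↔ t) ≤ μA` give `P_{W'}(⋃ t ∈ B₀, o ↔ t) − (N+1)(C·δ + η) ≤ μA` for every `B₀ ⊆ X^{(0)}_0`, with the absolute
constant `C` of `KNLevels.chain_edge_additive_F_KN` (handed in as the hypothesis `hC`, so that a closure fixes `C` once).
[cite: KozmaNitzan2024, §4 Lemma 11 (pp. 22–23), Lemma 12 (pp. 23–25)] [this work] -/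
theorem le_real_of_chainFF [Countable V] (hRl : P.Rlev + 1 ≤ S.R') (hRim : ∀ k, P.Rim k ⊆ 𝒲.stepDF S k)
    (hTne : ∀ k ≤ S.N, (𝒲.coreTF S k).Nonempty)
    {p : unitInterval} (hp1 : (p : ℝ) < 1) {W' : Sym2 V → unitInterval} {Ft B₀ : Finset V} {μA : ℝ} {Δ' : ℕ} (hΔ : ∀ x, G'.degree x ≤ Δ')
    {δ η C : ℝ} (hδ : 0 < δ) (hδ1 : δ ≤ 1)
    (hC : ∀ (n : ℕ) ⦃δ : ℝ⦄, 0 < δ → δ ≤ 1 → ∀ (p : unitInterval), (p : ℝ) < 1 →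
      ∀ (G : SimpleGraph V) [G.LocallyFinite], (∀ x, G.degree x ≤ Δ') →
      ∀ (W : Sym2 V → unitInterval) (s : Fin (n + 1) → TStep G) (T' : Fin (n + 1) → Finset V) (η : ℝ),
      (∀ i : Fin (n + 1), (s i).L.o = (s 0).L.o) →
      (∀ i : Fin n, T' (Fin.castSucc i) ⊆ (s i.succ).L.X 0) →
      (∀ i : Fin (n + 1), T' i ⊆ (s i).T) →
      (∀ i : Fin (n + 1), (s i).KitsAtF W p Δ' δ) →
      (∀ i : Fin (n + 1), (prodBernoulli W).real (⋃ t ∈ (s i).T \ T' i, openConn (s 0).L.o t) ≤ η) →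
        (prodBernoulli W).real (s 0).L.reachB - (n + 1 : ℕ) * (C * δ + η) ≤
          (prodBernoulli W).real (⋃ t ∈ T' (Fin.last n), openConn (s 0).L.o t))
    (hsub : ∀ k ≤ S.N, IsSubbox G' W' p (𝒲.stepDF S k)) (hfin : FinSupp W' P.Sfin)
    (hDS : ∀ k ≤ S.N, 𝒲.stepDF S k ⊆ P.Sfin) (ho : ∀ k ≤ S.N, P.o ∉ 𝒲.stepDF S k) (hoS : P.o ∈ P.Sfin) (hj : P.j₁ ≤ P.Rlev)
    (hcount : 1 / (1 - (p : ℝ)) ^ (Δ' * P.N) ≤ δ * ((Finset.Icc P.j₀ P.j₁).card : ℝ))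
    (hkits : ∀ k ≤ S.N, ∀ j ∈ Finset.Icc P.j₀ P.j₁, ∃ (σ : SData V) (Sz : Finset V),
      SHyp (P.stepLF 𝒲 S k) j σ ∧ σ.N ≤ P.N ∧ (1 - (p : ℝ) ^ σ.sB) ^ σ.k ≤ δ ∧ Sz ⊆ 𝒲.stepDF S k ∧ (∀ x ∈ σ.K, σ.face x ⊆ Sz) ∧
      RelayClause (P.stepLF 𝒲 S k) W' j σ Sz (P.coreEF 𝒲 S k) (𝒲.stepDF S k) δ)
    (hexc : ∀ k ≤ S.N, (prodBernoulli W').real (⋃ t ∈ P.Rim k, openConn P.o t) ≤ η)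
    (hB₀ : B₀ ⊆ (P.stepLF 𝒲 S 0).X 0)
    (hTn : 𝒲.coreTF S S.N ⊆ Ft) (hdom : (prodBernoulli W').real (⋃ t ∈ Ft, openConn P.o t) ≤ μA) :
    (prodBernoulli W').real (⋃ t ∈ B₀, openConn P.o t) - (S.N + 1 : ℕ) * (C * δ + η) ≤ μA := by
  let s : Fin (S.N + 1) → TStep G' := fun i => P.stepAF 𝒲 S i
  let T' : Fin (S.N + 1) → Finset V := fun i => 𝒲.coreTF S i
  have hle : ∀ i : Fin (S.N + 1), (i : ℕ) ≤ S.N := fun i => Nat.lt_succ_iff.1 i.2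
  have hmain := hC S.N hδ hδ1 p hp1 G' hΔ W' s T' η (fun i => P.stepAF_o 𝒲 S i) (fun i => ?_) (fun i => P.coreTF_subset_coreEF 𝒲 S i)
    (fun i => ?_) (fun i => ?_)
  · -- source and target ends
    have hsrc : (prodBernoulli W').real (⋃ t ∈ B₀, openConn P.o t) ≤ (prodBernoulli W').real (s 0).L.reachB := by
      refine measureReal_mono (fun ω hω => ?_) (measure_ne_top _ _)
      simp only [Set.mem_iUnion, exists_prop] at hω
      obtain ⟨t, ht, hωt⟩ := hω
      show ω ∈ (P.stepLF 𝒲 S ((0 : Fin (S.N + 1)) : ℕ)).reachB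
      rw [Fin.val_zero]
      exact Set.mem_biUnion (Finset.mem_coe.2 (hB₀ ht)) hωt
    have hlast : (prodBernoulli W').real (⋃ t ∈ T' (Fin.last S.N), openConn (s 0).L.o t) ≤ μA := by
      refine le_trans (measureReal_mono (fun ω hω => ?_) (measure_ne_top _ _)) hdom
      simp only [Set.mem_iUnion, exists_prop] at hω ⊢
      obtain ⟨t, ht, hωt⟩ := hω
      refine ⟨t, hTn ?_, hωt⟩
      have : 𝒲.coreTF S ((Fin.last S.N : Fin (S.N + 1)) : ℕ) = 𝒲.coreTF S S.N := by rw [Fin.val_last]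
      rw [← this]; exact ht
    have ho0 : (s 0).L.o = P.o := P.stepAF_o 𝒲 S _
    rw [ho0] at hmain hlast
    linarith
  · -- the true targets link the chain
    show 𝒲.coreTF S (Fin.castSucc i) ⊆ (P.stepAF 𝒲 S i.succ).L.X 0
    have : ((i.succ : Fin (S.N + 1)) : ℕ) = (Fin.castSucc i : ℕ) + 1 := by simp
    rw [show P.stepAF 𝒲 S (i.succ : ℕ) = P.stepAF 𝒲 S ((Fin.castSucc i : ℕ) + 1) by rw [this]]
    exact P.coreTF_subset_X_zero_succ 𝒲 S _
  · exact P.kitsAt_stepAFF 𝒲 S hRl hRim (hle i) (hTne i (hle i)) (hsub i (hle i)) hfin (hDS i (hle i)) (ho i (hle i)) hoS hj hcount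
      (hkits i (hle i))
  · -- the excess of the enlarged target is inside the rim part
    rw [P.stepAF_o 𝒲 S]
    refine le_trans (measureReal_mono ?_ (measure_ne_top _ _)) (hexc i (hle i))
    intro ω hω
    simp only [Set.mem_iUnion, exists_prop] at hω ⊢
    obtain ⟨t, ht, hωt⟩ := hω
    exact ⟨t, P.coreEF_sdiff_subset 𝒲 S i ht, hωt⟩


/-- **THE THRESHOLD-SHAPED WINDOW CHAIN OVER (S0)-SHAPE KITS** (`lt_real_of_chainF` with `KitsAt ↦ KitsAtF` and nothing else touched — the shape
the (F) column's readers consume): the chain of `S.N + 1` steps in `G'` under `W'` with per-step facts and per-level forced-kit clauses, nonempty true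
targets, rim excess `≤ η ≤ δ/2`, a chain property of length `S.N + 1` at `(δ ↦ ε'')` quantified over steps with `KitsAtF`, a source bound towards
`B₀ ⊆ X^{(0)}_0`, the last core inside `Ft` and `P_{W'}(⋃ t ∈ Ft, o ↔ t) ≤ μA` give `1 − ε'' < μA`.
[cite: KozmaNitzan2024, §4 Lemma 11 (pp. 22–23), Lemma 12 (pp. 23–25), p. 20 (Step IV)] [this work] -/
theorem lt_real_of_chainFF (hRl : P.Rlev + 1 ≤ S.R') (hRim : ∀ k, P.Rim k ⊆ 𝒲.stepDF S k)
    (hTne : ∀ k ≤ S.N, (𝒲.coreTF S k).Nonempty)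
    {p : unitInterval} {W' : Sym2 V → unitInterval} {Ft B₀ : Finset V} {μA : ℝ} {Δ' : ℕ} {δ ε'' η : ℝ}
    (hchain : ∀ (Wg : Sym2 V → unitInterval) (s : Fin (S.N + 1) → TStep G')
      (T' : Fin (S.N + 1) → Finset V) (η : ℝ),
      (∀ i, (s i).L.o = (s 0).L.o) →
      (∀ i : Fin S.N, T' (Fin.castSucc i) ⊆ (s i.succ).L.X 0) →
      (∀ i, T' i ⊆ (s i).T) →
      (∀ i, (s i).KitsAtF Wg p Δ' δ) →
      η ≤ δ / 2 →
      (∀ i, (prodBernoulli Wg).real (⋃ t ∈ (s i).T \ T' i, openConn (s 0).L.o t) ≤ η) →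
      1 - δ < (prodBernoulli Wg).real (s 0).L.reachB →
        1 - ε'' < (prodBernoulli Wg).real (⋃ t ∈ T' (Fin.last S.N), openConn (s 0).L.o t))
    (hsub : ∀ k ≤ S.N, IsSubbox G' W' p (𝒲.stepDF S k)) (hfin : FinSupp W' P.Sfin)
    (hDS : ∀ k ≤ S.N, 𝒲.stepDF S k ⊆ P.Sfin) (ho : ∀ k ≤ S.N, P.o ∉ 𝒲.stepDF S k) (hoS : P.o ∈ P.Sfin) (hj : P.j₁ ≤ P.Rlev)
    (hcount : 1 / (1 - (p : ℝ)) ^ (Δ' * P.N) ≤ δ * ((Finset.Icc P.j₀ P.j₁).card : ℝ))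
    (hkits : ∀ k ≤ S.N, ∀ j ∈ Finset.Icc P.j₀ P.j₁, ∃ (σ : SData V) (Sz : Finset V),
      SHyp (P.stepLF 𝒲 S k) j σ ∧ σ.N ≤ P.N ∧ (1 - (p : ℝ) ^ σ.sB) ^ σ.k ≤ δ ∧ Sz ⊆ 𝒲.stepDF S k ∧ (∀ x ∈ σ.K, σ.face x ⊆ Sz) ∧
      RelayClause (P.stepLF 𝒲 S k) W' j σ Sz (P.coreEF 𝒲 S k) (𝒲.stepDF S k) δ)
    (hη : η ≤ δ / 2) (hexc : ∀ k ≤ S.N, (prodBernoulli W').real (⋃ t ∈ P.Rim k, openConn P.o t) ≤ η)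
    (hB₀ : B₀ ⊆ (P.stepLF 𝒲 S 0).X 0) (hsrc : 1 - δ < (prodBernoulli W').real (⋃ t ∈ B₀, openConn P.o t))
    (hTn : 𝒲.coreTF S S.N ⊆ Ft) (hdom : (prodBernoulli W').real (⋃ t ∈ Ft, openConn P.o t) ≤ μA) :
    1 - ε'' < μA := by
  let s : Fin (S.N + 1) → TStep G' := fun i => P.stepAF 𝒲 S i
  let T' : Fin (S.N + 1) → Finset V := fun i => 𝒲.coreTF S i
  have hle : ∀ i : Fin (S.N + 1), (i : ℕ) ≤ S.N := fun i => Nat.lt_succ_iff.1 i.2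
  have ho' : ∀ i : Fin (S.N + 1), (s i).L.o = (s 0).L.o := fun i => by
    show (P.stepAF 𝒲 S i).L.o = (P.stepAF 𝒲 S ((0 : Fin (S.N + 1)) : ℕ)).L.o
    rw [P.stepAF_o, P.stepAF_o]
  have hlink : ∀ i : Fin S.N, T' (Fin.castSucc i) ⊆ (s i.succ).L.X 0 := fun i => by
    show 𝒲.coreTF S (Fin.castSucc i) ⊆ (P.stepAF 𝒲 S i.succ).L.X 0
    have : ((i.succ : Fin (S.N + 1)) : ℕ) = (Fin.castSucc i : ℕ) + 1 := by simp
    rw [show P.stepAF 𝒲 S (i.succ : ℕ) = P.stepAF 𝒲 S ((Fin.castSucc i : ℕ) + 1) by rw [this]]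
    exact P.coreTF_subset_X_zero_succ 𝒲 S _
  have hkitsF : ∀ i : Fin (S.N + 1), (s i).KitsAtF W' p Δ' δ := fun i =>
    P.kitsAt_stepAFF 𝒲 S hRl hRim (hle i) (hTne i (hle i)) (hsub i (hle i)) hfin (hDS i (hle i)) (ho i (hle i)) hoS hj hcount (hkits i (hle i))
  have ho0 : (s 0).L.o = P.o := P.stepAF_o 𝒲 S _
  have hexc' : ∀ i : Fin (S.N + 1), (prodBernoulli W').real (⋃ t ∈ (s i).T \ T' i, openConn (s 0).L.o t) ≤ η := fun i => by
    rw [ho0]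
    refine le_trans (measureReal_mono ?_ (measure_ne_top _ _)) (hexc i (hle i))
    intro ω hω
    simp only [Set.mem_iUnion, exists_prop] at hω ⊢
    obtain ⟨t, ht, hωt⟩ := hω
    exact ⟨t, P.coreEF_sdiff_subset 𝒲 S i ht, hωt⟩
  have hsrc' : 1 - δ < (prodBernoulli W').real (s 0).L.reachB := by
    refine hsrc.trans_le (measureReal_mono (fun ω hω => ?_) (measure_ne_top _ _))
    simp only [Set.mem_iUnion, exists_prop] at hω
    obtain ⟨t, ht, hωt⟩ := hω
    show ω ∈ (P.stepLF 𝒲 S ((0 : Fin (S.N + 1)) : ℕ)).reachB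
    rw [Fin.val_zero]
    exact Set.mem_biUnion (Finset.mem_coe.2 (hB₀ ht)) hωt
  have hc := hchain W' s T' η ho' hlink (fun i => P.coreTF_subset_coreEF 𝒲 S i) hkitsF hη hexc' hsrc'
  rw [ho0] at hc
  refine hc.trans_le (le_trans (measureReal_mono (fun ω hω => ?_) (measure_ne_top _ _)) hdom)
  simp only [Set.mem_iUnion, exists_prop] at hω ⊢
  obtain ⟨t, ht, hωt⟩ := hω
  refine ⟨t, hTn ?_, hωt⟩
  have : 𝒲.coreTF S ((Fin.last S.N : Fin (S.N + 1)) : ℕ) = 𝒲.coreTF S S.N := by rw [Fin.val_last]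
  rw [← this]; exact ht

end WinChainData

end Skelφ

end Summit.CriticalPhenomena.PercolationContinuityZ3.Theorems.Transplant

end
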